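/-
Copyright: statement-level skeleton of a published paper (lit-balaban cell, reader/typer r15). No proof claims beyond
what the kernel checks below.
-/
import Literature.MathematicalPhysics.QuantumFieldTheory.Balaban1983to89.B3Sect3VectorSelfEnergy

/-!
# B3 — T. Bałaban, *(Higgs)₂,₃ quantum fields in a finite volume. III. Renormalization*, CMP **88** (1983) 411–445
[Balaban1983Higgs3], Sect. 3 pp. 443–444: the graphs with two scalar legs and one vector leg, (3.33)–(3.38)

statement-level skeleton of published theorems with citation tags; proofs where landed; nothing here is a claim about
the Yang–Mills mass gap

Source: held text `paper:balaban1983-higgs-2-3-quantum-fields-finite-volume` (journal page = PDF page + 410); renders of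
pp. 443–444 read as images (`run/shared/lean/pub/pub-balaban/b2b-balaban-ref1/pages/1983-cmp88-higgs23-III/…-p033,p034-x2.png`,
strip crops).  Row **B3.Eq3.33-3.38** of `HOME/lit-balaban-r15/ROWS-B3.md` (reader/typer r15, fold owner of B3) — the displays
themselves; the parity MECHANISM of (3.37)/(3.38) on a finite torus is the earlier `B3Sect3Statements.sum_even_mul_centralDiff_eq_zero`
(p239220).  CARRIERS: the torus calculus of the sibling files (`Site P j`, `SiteField`, `VecField`, `LatticeFieldCalculus.supDist`)
for (3.33)–(3.36), scalar legs φ′, φ″ with values in a real inner-product space `W` (the paper: ℝ^N) and the three-point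
kernel Γ_μ(x,x′,x″) acting on the internal indices as a linear map of `W`; the infinite ξ-lattice ξℤ^d of
`B3Sect3VectorSelfEnergy` (`ZSite`, `pdiffZ`, `pdiffAdjZ`, `unitVec`, the momentum-integral propagator `Cxi`) for (3.37)–(3.38).

THE PRINTED TEXT (verbatim).  p. 443 [PDF 33]: *"Thus we have to consider the graphs (2.18)–(2.20), (2.21b), and the
counterterms (2.21g) and (2.21c). Only the first three classes are primitively divergent. Generally an expression corresponding
to these graphs has the form Σ_{x,x′,x″} η^{3d} Σ_{μ=1}^d g(x)A_μ(x)φ′(x′)·Γ_μ(x,x′,x″)φ″(x″) (3.33) and the degree is 0. We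
transform this expression transporting all the legs to one vertex. More precisely we transport the legs with the lowest
j-indices to a vertex having a leg with highest index. For example, if φ′ is such a leg, then
(3.33) = Σ_{x,x′,x″} η^{3d} Σ_{μ=1}^d [ (g(x)A_μ(x) − g(x′)A_μ(x′))/|x−x′|^α φ′(x′)·Γ_μ(x,x′,x″)|x−x′|^α φ″(x″)
+ g(x′)A_μ(x′)φ′(x′)·Γ_μ(x,x′,x″)|x″−x′|^α (φ″(x″) − φ″(x′))/|x″−x′|^α ]
+ Σ_{x′} η^d Σ_{μ=1}^d g(x′)A_μ(x′)φ′(x′)·(Σ_{x,x″} η^{2d}Γ_μ(x,x′,x″)) φ″(x′). (3.34)"*  p. 444 [PDF 34]: *"This gives us a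
convergent expression plus the expression Σ_{x′} η^d Σ_{μ=1}^d g(x′)A_μ(x′)φ′(x′)·(a product of the values of all the
localization functions at the point x′)(Σ_{x,x″} η^{2d}Γ′_μ(x,x′,x″)) φ″(x′), (3.36) where Γ′_μ is given by the same formula
as before, but with the summations unrestricted. … This expression for the graphs (2.19) equals
−q³ Σ_y ξ^d[(C^ξ∂^{ξ*}_μ)(y−y′)C^ξ(y−y′) − (∂^ξ_μC^ξ)(y−y′)C^ξ(y−y′)] = 0. (3.37) For the graph (2.21c) it equals 0 also
because by translation invariance it can be written as a derivative of a constant. Finally for the graphs (2.20) it equals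
−q³ Σ_{y,y″} ξ^{2d} Σ_{ν=1}^d [(∂^ξ_νC^ξ)(y′−y)(∂^ξ_μC^ξ∂^{ξ*}_ν)(y−y″)C^ξ(y′−y″) − (∂^ξ_νC^ξ∂^{ξ*}_μ)(y′−y)(C^ξ∂^{ξ*}_ν)(y−y″)
C^ξ(y′−y″)] = −q³ Σ_{y,y″} ξ^{2d}(−Δ^ξC^ξ)(y″)C^ξ(y″−y)((∂^ξ_μC^ξ)(y) − (∂^{ξ*}_μC^ξ)(y))
= −q³Σ_y ξ^dC^ξ(y)(C^ξ(y+ξe_μ) − C^ξ(y−ξe_μ))/ξ + q³Σ_y ξ^d(C^ξ∗C^ξ)(y)(C^ξ(y+ξe_μ) − C^ξ(y−ξe_μ))/ξ = 0, (3.38) because the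
functions which we are summing are odd."*

WHAT IS TYPED / PROVED.  §1: **(3.33)** as a def with body (`tripleSum`, `expr333`) and **(3.34) PROVED** verbatim
(`eq334`, with |x−x′| = η·(sup torus distance); generic two-weight form `eq334_of_weights`); (3.36) is the local (last) term of
(3.34) with Γ′ in place of Γ (`local336`).  §2 (ξℤ^d): **(3.37) PROVED** for EVERY even kernel, in particular for C^ξ itself
(`eq337`, `eq337_Cxi`; the translation-invariant kernels (C∂^{ξ*}_μ)(u) = (∂^{ξ*}_μC)(u) as in the sibling file; lattice sums
as `tsum`, no convergence needed: the summand is odd); **(3.38)**: its first member typed (`lhs338`), its last member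
(`last338`, with the lattice convolution `convZ` = C^ξ∗C^ξ) **PROVED to vanish** for every even kernel, in particular C^ξ
(`convZ_neg_of_even`, `last338_eq_zero`, `last338_Cxi_eq_zero`), and the printed chain first member = last member typed as
`Eq338` (its middle member and the reduction by −Δ^ξC^ξ = δ^ξ − C^ξ are not typed) with `lhs338_eq_zero_of_eq338`.
TRANSCRIPT NOTES.  T1: the insert-and-divide weights of (3.34) are performed verbatim (as in `B3Sect3VectorSelfEnergy.eq331`);
T2: (C^ξ∗C^ξ)(y) is read as the ξ-lattice convolution Σ_zξ^dC^ξ(z)C^ξ(y−z) (T5 of the sibling: `tsum`).  NOT TYPED: the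
pictures (3.35), the prose claims (vanishing for (2.21b)/(2.21g)/(2.18)/(2.21c), "convergent", degree bookkeeping).
NOTHING beyond the kernel-checked statements below is asserted.
-/

open scoped BigOperators RealInnerProductSpace

namespace Literature.MathematicalPhysics.QuantumFieldTheory.Balaban1983to89.B3Sect3TriangleGraphs

open LatticeFieldCalculus B3Sect3ScalarSelfEnergy B3Sect3VectorSelfEnergy

noncomputable section

/-! ## 1. (3.33), (3.34), (3.36) on the torus -/

section Torus

variable {P : Params} {j : ℕ} {W : Type*} [NormedAddCommGroup W] [InnerProductSpace ℝ W]

/-- The three-point kernels Γ_μ(x,x′,x″) of (3.33), acting on the internal indices of the scalar legs. [cite: Balaban1983Higgs3, (3.33) p.443] -/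
abbrev Kernel3 (P : Params) (j : ℕ) (W : Type*) [NormedAddCommGroup W] [InnerProductSpace ℝ W] : Type _ :=
  Fin P.d → Site P j → Site P j → Site P j → (W →ₗ[ℝ] W)

/-- The generic three-point pairing behind (3.33)/(3.34): Σ_{x,x′,x″}η^{3d}Σ_μ F_μ(x,x′)·φ′(x′)·Γ_μ(x,x′,x″)H(x,x′,x″) with the
vector leg read by `F` (g(x)A_μ(x) in (3.33); the transported readings in (3.34)) and the second scalar leg by `H` (φ″(x″) in
(3.33)). [cite: Balaban1983Higgs3, (3.33) p.443] -/
def tripleSum (η : ℝ) (Γ : Kernel3 P j W) (F : Fin P.d → Site P j → Site P j → ℝ) (φ' : SiteField P j W)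
    (H : Site P j → Site P j → Site P j → W) : ℝ :=
  ∑ x : Site P j, ∑ x' : Site P j, ∑ x'' : Site P j, η ^ (3 * P.d) *
    ∑ μ : Fin P.d, F μ x x' * ⟪φ' x', Γ μ x x' x'' (H x x' x'')⟫

/-- **(3.33)** p. 443 [PDF 33], verbatim: *"Σ_{x,x′,x″} η^{3d} Σ_{μ=1}^d g(x)A_μ(x)φ′(x′)·Γ_μ(x,x′,x″)φ″(x″) (3.33)"*
(A_μ(x) = A ⟨x, μ⟩). [cite: Balaban1983Higgs3, (3.33) p.443] -/
def expr333 (η : ℝ) (Γ : Kernel3 P j W) (g : SiteField P j ℝ) (A : VecField P j ℝ) (φ' φ'' : SiteField P j W) : ℝ :=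
  tripleSum η Γ (fun μ x _ => g x * A ⟨x, μ⟩) φ' (fun _ _ x'' => φ'' x'')

/-- The local (last) term of **(3.34)** p. 443: Σ_{x′}η^dΣ_μ g(x′)A_μ(x′)φ′(x′)·(Σ_{x,x″}η^{2d}Γ_μ(x,x′,x″))φ″(x′).
[cite: Balaban1983Higgs3, (3.34) p.443] -/
def local334 (η : ℝ) (Γ : Kernel3 P j W) (g : SiteField P j ℝ) (A : VecField P j ℝ) (φ' φ'' : SiteField P j W) : ℝ :=
  ∑ x' : Site P j, η ^ P.d * ∑ μ : Fin P.d, g x' * A ⟨x', μ⟩ *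
    ⟪φ' x', (∑ x : Site P j, ∑ x'' : Site P j, η ^ (2 * P.d) • Γ μ x x' x'') (φ'' x')⟫

/-- **(3.36)** p. 444 [PDF 34]: the same local term with the unrestricted kernel Γ′_μ and the product `locs x′` of the values of all
the localization functions at x′ in place of g(x′): Σ_{x′}η^dΣ_μ locs(x′)A_μ(x′)φ′(x′)·(Σ_{x,x″}η^{2d}Γ′_μ(x,x′,x″))φ″(x′).
[cite: Balaban1983Higgs3, (3.36) p.444] -/
def local336 (η : ℝ) (Γ' : Kernel3 P j W) (locs : SiteField P j ℝ) (A : VecField P j ℝ) (φ' φ'' : SiteField P j W) : ℝ :=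
  local334 η Γ' locs A φ' φ''

/-- η^{3d} = η^d·η^{2d}. [folklore] -/
private theorem pow_three_mul' (η : ℝ) (n : ℕ) : η ^ (3 * n) = η ^ n * η ^ (2 * n) := by
  rw [← pow_add]
  congr 1
  ring

/-- kernel: the pairing is additive in the pair (vector-leg reading, second-leg reading) when one of them is fixed — additivity
in `H`. [cite: Balaban1983Higgs3, (3.34) p.443] -/
theorem tripleSum_add_H (η : ℝ) (Γ : Kernel3 P j W) (F : Fin P.d → Site P j → Site P j → ℝ) (φ' : SiteField P j W)
    (H H' : Site P j → Site P j → Site P j → W) :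
    tripleSum η Γ F φ' (fun x x' x'' => H x x' x'' + H' x x' x'') = tripleSum η Γ F φ' H + tripleSum η Γ F φ' H' := by
  simp only [tripleSum, map_add, inner_add_right, mul_add, Finset.sum_add_distrib]

/-- kernel: the local reading (both legs at x′) of the pairing collapses the x, x″ sums onto the kernel — the last term of (3.34).
[cite: Balaban1983Higgs3, (3.34) p.443] -/
theorem tripleSum_local (η : ℝ) (Γ : Kernel3 P j W) (g : SiteField P j ℝ) (A : VecField P j ℝ) (φ' φ'' : SiteField P j W) :
    tripleSum η Γ (fun μ _ x' => g x' * A ⟨x', μ⟩) φ' (fun _ x' _ => φ'' x') = local334 η Γ g A φ' φ'' := by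
  have hR : local334 η Γ g A φ' φ'' = ∑ x' : Site P j, ∑ μ : Fin P.d, ∑ x : Site P j, ∑ x'' : Site P j,
      η ^ (3 * P.d) * (g x' * A ⟨x', μ⟩ * ⟪φ' x', Γ μ x x' x'' (φ'' x')⟫) := by
    simp only [local334, LinearMap.sum_apply, LinearMap.smul_apply, inner_sum, inner_smul_right, Finset.mul_sum]
    refine Finset.sum_congr rfl fun x' _ => Finset.sum_congr rfl fun μ _ =>
      Finset.sum_congr rfl fun x _ => Finset.sum_congr rfl fun x'' _ => ?_
    rw [pow_three_mul']
    ring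
  have hL : tripleSum η Γ (fun μ _ x' => g x' * A ⟨x', μ⟩) φ' (fun _ x' _ => φ'' x') =
      ∑ x : Site P j, ∑ x' : Site P j, ∑ x'' : Site P j, ∑ μ : Fin P.d,
        η ^ (3 * P.d) * (g x' * A ⟨x', μ⟩ * ⟪φ' x', Γ μ x x' x'' (φ'' x')⟫) := by
    simp only [tripleSum, Finset.mul_sum]
  rw [hL, hR]
  calc (∑ x : Site P j, ∑ x' : Site P j, ∑ x'' : Site P j, ∑ μ : Fin P.d,
        η ^ (3 * P.d) * (g x' * A ⟨x', μ⟩ * ⟪φ' x', Γ μ x x' x'' (φ'' x')⟫))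
      = ∑ x' : Site P j, ∑ x : Site P j, ∑ x'' : Site P j, ∑ μ : Fin P.d,
        η ^ (3 * P.d) * (g x' * A ⟨x', μ⟩ * ⟪φ' x', Γ μ x x' x'' (φ'' x')⟫) := Finset.sum_comm
    _ = ∑ x' : Site P j, ∑ x : Site P j, ∑ μ : Fin P.d, ∑ x'' : Site P j,
        η ^ (3 * P.d) * (g x' * A ⟨x', μ⟩ * ⟪φ' x', Γ μ x x' x'' (φ'' x')⟫) :=
        Finset.sum_congr rfl fun x' _ => Finset.sum_congr rfl fun x _ => Finset.sum_comm
    _ = ∑ x' : Site P j, ∑ μ : Fin P.d, ∑ x : Site P j, ∑ x'' : Site P j,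
        η ^ (3 * P.d) * (g x' * A ⟨x', μ⟩ * ⟪φ' x', Γ μ x x' x'' (φ'' x')⟫) :=
        Finset.sum_congr rfl fun x' _ => Finset.sum_comm

/-- **(3.34)** p. 443 [PDF 33], generic form — PROVED for any two weights vanishing only on the diagonal (in print w₁(x,x′) =
|x−x′|^α, w₂(x″,x′) = |x″−x′|^α): (3.33) = Σ η^{3d}Σ_μ[ (gA_μ(x) − gA_μ(x′))/w₁ φ′(x′)·Γ w₁φ″(x″) + gA_μ(x′)φ′(x′)·Γ w₂(φ″(x″) −
φ″(x′))/w₂ ] + (local term). [cite: Balaban1983Higgs3, (3.34) p.443] -/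
theorem eq334_of_weights (η : ℝ) (Γ : Kernel3 P j W) (g : SiteField P j ℝ) (A : VecField P j ℝ) (φ' φ'' : SiteField P j W)
    (w₁ w₂ : Site P j → Site P j → ℝ) (hw₁ : ∀ x x', w₁ x x' = 0 → x = x') (hw₂ : ∀ x x', w₂ x x' = 0 → x = x') :
    expr333 η Γ g A φ' φ'' =
      tripleSum η Γ (fun μ x x' => (g x * A ⟨x, μ⟩ - g x' * A ⟨x', μ⟩) / w₁ x x') φ' (fun x x' x'' => w₁ x x' • φ'' x'') +
        tripleSum η Γ (fun μ _ x' => g x' * A ⟨x', μ⟩) φ'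
          (fun _ x' x'' => w₂ x'' x' • ((w₂ x'' x')⁻¹ • (φ'' x'' - φ'' x'))) +
        local334 η Γ g A φ' φ'' := by
  rw [← tripleSum_local, add_assoc, ← tripleSum_add_H]
  simp only [expr333, tripleSum]
  rw [← Finset.sum_add_distrib]
  refine Finset.sum_congr rfl fun x _ => ?_
  rw [← Finset.sum_add_distrib]
  refine Finset.sum_congr rfl fun x' _ => ?_
  rw [← Finset.sum_add_distrib]
  refine Finset.sum_congr rfl fun x'' _ => ?_
  rw [← mul_add, ← Finset.sum_add_distrib]
  congr 1
  refine Finset.sum_congr rfl fun μ _ => ?_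
  -- the two transports, pointwise
  have h2 : w₂ x'' x' • ((w₂ x'' x')⁻¹ • (φ'' x'' - φ'' x')) + φ'' x' = φ'' x'' := by
    by_cases h0 : w₂ x'' x' = 0
    · have hx := hw₂ x'' x' h0
      subst hx
      rw [sub_self, smul_zero, smul_zero, zero_add]
    · rw [smul_smul, mul_inv_cancel₀ h0, one_smul, sub_add_cancel]
  rw [h2, map_smul, inner_smul_right]
  by_cases h1 : w₁ x x' = 0
  · have hx := hw₁ x x' h1
    subst hx
    rw [sub_self, zero_div, zero_mul, zero_add]
  · rw [← mul_assoc, div_mul_cancel₀ _ h1]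
    ring

/-- kernel: on the torus, sup-distance 0 means equality. [folklore] -/
private theorem eq_of_supDist_eq_zero' (x x' : Site P j) (h : supDist x x' = 0) : x = x' := by
  funext μ
  have hle : min (x μ - x' μ).val (x' μ - x μ).val ≤ supDist x x' :=
    Finset.le_sup (f := fun μ : Fin P.d => min (x μ - x' μ).val (x' μ - x μ).val) (Finset.mem_univ μ)
  rw [h, Nat.le_zero, Nat.min_eq_zero_iff, ZMod.val_eq_zero, ZMod.val_eq_zero, sub_eq_zero, sub_eq_zero] at hle
  rcases hle with h1 | h1
  · exact h1
  · exact h1.symm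

/-- kernel: the printed weight |x−x′|^α = (η·supDist)^α vanishes only on the diagonal (η > 0). [folklore] -/
private theorem rpow_dist_eq_zero {η : ℝ} (hη : 0 < η) (α : ℝ) (x x' : Site P j)
    (h0 : (η * (supDist x x' : ℝ)) ^ α = 0) : x = x' := by
  have hnn : 0 ≤ η * (supDist x x' : ℝ) := by positivity
  rw [Real.rpow_eq_zero_iff_of_nonneg hnn] at h0
  have h1 : (supDist x x' : ℝ) = 0 := by
    rcases mul_eq_zero.1 h0.1 with h2 | h2
    · exact absurd h2 hη.ne'
    · exact h2
  exact eq_of_supDist_eq_zero' x x' (by exact_mod_cast h1)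

/-- **(3.34)** p. 443 [PDF 33], verbatim (see the module docstring) — PROVED with |x−x′| = η·(sup torus distance in lattice steps,
`LatticeFieldCalculus.supDist`), η > 0, any real exponent α (T1). [cite: Balaban1983Higgs3, (3.34) p.443] -/
theorem eq334 (η α : ℝ) (hη : 0 < η) (Γ : Kernel3 P j W) (g : SiteField P j ℝ) (A : VecField P j ℝ)
    (φ' φ'' : SiteField P j W) :
    expr333 η Γ g A φ' φ'' =
      tripleSum η Γ (fun μ x x' => (g x * A ⟨x, μ⟩ - g x' * A ⟨x', μ⟩) / (η * supDist x x') ^ α) φ'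
          (fun x x' x'' => (η * supDist x x') ^ α • φ'' x'') +
        tripleSum η Γ (fun μ _ x' => g x' * A ⟨x', μ⟩) φ'
          (fun _ x' x'' => (η * supDist x'' x') ^ α • (((η * supDist x'' x') ^ α)⁻¹ • (φ'' x'' - φ'' x'))) +
        local334 η Γ g A φ' φ'' :=
  eq334_of_weights η Γ g A φ' φ'' (fun x x' => (η * supDist x x') ^ α) (fun x x' => (η * supDist x x') ^ α)
    (fun x x' h => rpow_dist_eq_zero hη α x x' h) (fun x x' h => rpow_dist_eq_zero hη α x x' h)

end Torus

/-! ## 2. (3.37), (3.38) on the ξ-lattice ξℤ^d -/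

section ZLattice

variable {d : ℕ}

/-- kernel: the sum over ℤ^d of an odd function vanishes (`tsum` reading; no convergence needed). [folklore] -/
private theorem tsum_eq_zero_of_odd (F : ZSite d → ℝ) (hF : ∀ z, F (-z) = -F z) : ∑' z : ZSite d, F z = 0 := by
  have h1 : ∑' z : ZSite d, F z = ∑' z : ZSite d, F (-z) := (Equiv.tsum_eq (Equiv.neg (ZSite d)) F).symm
  have h2 : ∑' z : ZSite d, F (-z) = -∑' z : ZSite d, F z := by
    rw [← tsum_neg]; exact tsum_congr hF
  linarith

/-- The left side of **(3.37)** p. 444 for a kernel C on ξℤ^d: −q³Σ_y ξ^d[(C∂^{ξ*}_μ)(y−y′)C(y−y′) − (∂^ξ_μC)(y−y′)C(y−y′)]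
(translation-invariant kernel (C∂^{ξ*}_μ)(u) = (∂^{ξ*}_μC)(u); `q3` = q³ as a real scalar on the internal indices).
[cite: Balaban1983Higgs3, (3.37) p.444] -/
def lhs337 (ξ q3 : ℝ) (C : ZSite d → ℝ) (y' : ZSite d) (μ : Fin d) : ℝ :=
  -q3 * ∑' y : ZSite d, ξ ^ d * (pdiffAdjZ ξ⁻¹ μ C (y - y') * C (y - y') - pdiffZ ξ⁻¹ μ C (y - y') * C (y - y'))

/-- **(3.37)** p. 444 [PDF 34], verbatim: *"This expression for the graphs (2.19) equals
−q³ Σ_y ξ^d[(C^ξ∂^{ξ*}_μ)(y−y′)C^ξ(y−y′) − (∂^ξ_μC^ξ)(y−y′)C^ξ(y−y′)] = 0. (3.37)"* — PROVED for every EVEN kernel C on ξℤ^d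
(translation y = u + y′; the summand u ↦ [(∂^{ξ*}_μC)(u) − (∂^ξ_μC)(u)]C(u) is odd by the two p. 441 identities).
[cite: Balaban1983Higgs3, (3.37) p.444] -/
theorem eq337 (ξ q3 : ℝ) (C : ZSite d → ℝ) (hC : ∀ z, C (-z) = C z) (y' : ZSite d) (μ : Fin d) :
    lhs337 ξ q3 C y' μ = 0 := by
  unfold lhs337
  rw [← Equiv.tsum_eq (Equiv.addRight y') _]
  simp only [Equiv.coe_addRight, add_sub_cancel_right]
  rw [tsum_eq_zero_of_odd _ fun z => ?_, mul_zero]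
  -- (∂^{ξ*}_μC)(−z) = (∂^ξ_μC)(z) for even C (from `pdiffZ_neg_of_even` at −z; v1 of the import has only that direction)
  have h1 : pdiffAdjZ ξ⁻¹ μ C (-z) = pdiffZ ξ⁻¹ μ C z := by
    rw [← pdiffZ_neg_of_even ξ⁻¹ μ C hC (-z), neg_neg]
  rw [h1, pdiffZ_neg_of_even _ _ C hC, hC]
  ring

/-- kernel: **(3.37) for C^ξ itself** (C^ξ is even, `Cxi_neg`). [cite: Balaban1983Higgs3, (3.37) p.444] -/
theorem eq337_Cxi (ξ q3 : ℝ) (y' : ZSite d) (μ : Fin d) : lhs337 ξ q3 (Cxi d ξ) y' μ = 0 :=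
  eq337 ξ q3 (Cxi d ξ) (Cxi_neg ξ) y' μ

/-- The lattice convolution (C∗C)(y) = Σ_z ξ^d C(z)C(y−z) of (3.38) (T2). [cite: Balaban1983Higgs3, (3.38) p.444] -/
def convZ (ξ : ℝ) (C : ZSite d → ℝ) (y : ZSite d) : ℝ :=
  ∑' z : ZSite d, ξ ^ d * (C z * C (y - z))

/-- kernel: the convolution of an even kernel with itself is even. [cite: Balaban1983Higgs3, (3.38) p.444] -/
theorem convZ_neg_of_even (ξ : ℝ) (C : ZSite d → ℝ) (hC : ∀ z, C (-z) = C z) (y : ZSite d) :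
    convZ ξ C (-y) = convZ ξ C y := by
  unfold convZ
  rw [← Equiv.tsum_eq (Equiv.neg (ZSite d)) _]
  refine tsum_congr fun z => ?_
  simp only [Equiv.neg_apply]
  rw [hC z, show -y - -z = -(y - z) by abel, hC (y - z)]

/-- The first member of **(3.38)** p. 444 for a kernel C on ξℤ^d (external point y′ of the leg):
−q³Σ_{y,y″}ξ^{2d}Σ_ν[(∂^ξ_νC)(y′−y)(∂^ξ_μC∂^{ξ*}_ν)(y−y″)C(y′−y″) − (∂^ξ_νC∂^{ξ*}_μ)(y′−y)(C∂^{ξ*}_ν)(y−y″)C(y′−y″)]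
(translation-invariant kernels as functions of the difference: (∂_μC∂^*_ν)(u) = (∂^ξ_μ∂^{ξ*}_νC)(u), (C∂^{ξ*}_ν)(u) = (∂^{ξ*}_νC)(u);
double lattice sum as an iterated `tsum`). [cite: Balaban1983Higgs3, (3.38) p.444] -/
def lhs338 (ξ q3 : ℝ) (C : ZSite d → ℝ) (y' : ZSite d) (μ : Fin d) : ℝ :=
  -q3 * ∑' y : ZSite d, ∑' y'' : ZSite d, ξ ^ (2 * d) * ∑ ν : Fin d,
    (pdiffZ ξ⁻¹ ν C (y' - y) * pdiffZ ξ⁻¹ μ (pdiffAdjZ ξ⁻¹ ν C) (y - y'') * C (y' - y'') -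
      pdiffZ ξ⁻¹ ν (pdiffAdjZ ξ⁻¹ μ C) (y' - y) * pdiffAdjZ ξ⁻¹ ν C (y - y'') * C (y' - y''))

/-- The last member of **(3.38)** p. 444: −q³Σ_yξ^dC(y)(C(y+ξe_μ) − C(y−ξe_μ))/ξ + q³Σ_yξ^d(C∗C)(y)(C(y+ξe_μ) − C(y−ξe_μ))/ξ.
[cite: Balaban1983Higgs3, (3.38) p.444] -/
def last338 (ξ q3 : ℝ) (C : ZSite d → ℝ) (μ : Fin d) : ℝ :=
  -q3 * ∑' y : ZSite d, ξ ^ d * (C y * ((C (y + unitVec μ) - C (y - unitVec μ)) / ξ)) +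
    q3 * ∑' y : ZSite d, ξ ^ d * (convZ ξ C y * ((C (y + unitVec μ) - C (y - unitVec μ)) / ξ))

/-- **(3.38)** p. 444 [PDF 34], its vanishing, verbatim: *"… = −q³Σ_yξ^dC^ξ(y)(C^ξ(y+ξe_μ) − C^ξ(y−ξe_μ))/ξ
+ q³Σ_yξ^d(C^ξ∗C^ξ)(y)(C^ξ(y+ξe_μ) − C^ξ(y−ξe_μ))/ξ = 0, (3.38) because the functions which we are summing are odd."* — PROVED
for every EVEN kernel C: both sums vanish (oddness of y ↦ C̃(y)(C(y+e) − C(y−e)) for even C̃ = C, C∗C — the finite-torus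
mechanism is `B3Sect3Statements.odd_even_mul_centralDiff`). [cite: Balaban1983Higgs3, (3.38) p.444] -/
theorem last338_eq_zero (ξ q3 : ℝ) (C : ZSite d → ℝ) (hC : ∀ z, C (-z) = C z) (μ : Fin d) : last338 ξ q3 C μ = 0 := by
  unfold last338
  have h1 : ∑' y : ZSite d, ξ ^ d * (C y * ((C (y + unitVec μ) - C (y - unitVec μ)) / ξ)) = 0 := by
    refine tsum_eq_zero_of_odd _ fun y => ?_
    rw [hC y, show -y + unitVec μ = -(y - unitVec μ) by abel, hC, show -y - unitVec μ = -(y + unitVec μ) by abel, hC]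
    ring
  have h2 : ∑' y : ZSite d, ξ ^ d * (convZ ξ C y * ((C (y + unitVec μ) - C (y - unitVec μ)) / ξ)) = 0 := by
    refine tsum_eq_zero_of_odd _ fun y => ?_
    rw [convZ_neg_of_even ξ C hC y, show -y + unitVec μ = -(y - unitVec μ) by abel, hC,
      show -y - unitVec μ = -(y + unitVec μ) by abel, hC]
    ring
  rw [h1, h2, mul_zero, mul_zero, add_zero]

/-- kernel: **(3.38)'s vanishing for C^ξ itself**. [cite: Balaban1983Higgs3, (3.38) p.444] -/
theorem last338_Cxi_eq_zero (ξ q3 : ℝ) (μ : Fin d) : last338 ξ q3 (Cxi d ξ) μ = 0 :=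
  last338_eq_zero ξ q3 (Cxi d ξ) (Cxi_neg ξ) μ

/-- **(3.38)** p. 444 [PDF 34], the printed chain for C^ξ, first member = last member (the middle member
−q³Σ_{y,y″}ξ^{2d}(−Δ^ξC^ξ)(y″)C^ξ(y″−y)((∂^ξ_μC^ξ)(y) − (∂^{ξ*}_μC^ξ)(y)) and the reduction by −Δ^ξC^ξ = δ^ξ − C^ξ of (3.16)
are not typed) — typed as a `Prop` (y′ the external point). [cite: Balaban1983Higgs3, (3.38) p.444] -/
def Eq338 (d : ℕ) (ξ q3 : ℝ) : Prop :=
  ∀ (y' : ZSite d) (μ : Fin d), lhs338 ξ q3 (Cxi d ξ) y' μ = last338 ξ q3 (Cxi d ξ) μ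

/-- kernel: under the printed chain (3.38), its first member vanishes. [cite: Balaban1983Higgs3, (3.38) p.444] -/
theorem lhs338_eq_zero_of_eq338 (ξ q3 : ℝ) (h : Eq338 d ξ q3) (y' : ZSite d) (μ : Fin d) :
    lhs338 ξ q3 (Cxi d ξ) y' μ = 0 := by
  rw [h y' μ, last338_Cxi_eq_zero]

end ZLattice

/-! ## v1.1 (append-only): the (2.21c) sentence of p. 444 — *"0 … by translation invariance … a derivative of a
constant"* — its lattice MECHANISM, PROVED -/

section TranslationInvariance

variable {d : ℕ}

/-- p. 444 [PDF 34], verbatim: *"For the graph (2.21c) it equals 0 also because by translation invariance it can be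
written as a derivative of a constant."* — the MECHANISM, PROVED on ξℤ^d: for a summable kernel `F` the lattice sum of a
translated difference quotient vanishes, Σ_y ξ^d(∂^ξ_μF)(y − y′) = ξ^d·c·[Σ_u F(u + e_μ) − Σ_u F(u)] = 0 — both sums are
the same constant by translation invariance of the counting measure, so the sum is "a derivative of a constant".  The
graph (2.21c) itself (a picture) and its kernel Γ″_μ are not typed; C^ξ's summability is not proved in the tree, so the
statement carries `Summable F` as a hypothesis. [cite: Balaban1983Higgs3, (3.37)–(3.38) p.444] -/
theorem tsum_pdiffZ_translate_eq_zero (ξ c : ℝ) (μ : Fin d) (F : ZSite d → ℝ) (hF : Summable F) (y' : ZSite d) :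
    ∑' y : ZSite d, ξ ^ d * pdiffZ c μ F (y - y') = 0 := by
  rw [← Equiv.tsum_eq (Equiv.addRight y') _]
  simp only [Equiv.coe_addRight, add_sub_cancel_right, pdiffZ]
  have hs : Summable fun u : ZSite d => F (u + unitVec μ) :=
    (Equiv.addRight (unitVec μ)).summable_iff.mpr hF
  have ht : ∑' u : ZSite d, F (u + unitVec μ) = ∑' u : ZSite d, F u :=
    Equiv.tsum_eq (Equiv.addRight (unitVec μ)) F
  rw [tsum_mul_left, tsum_mul_left, hs.tsum_sub hF, ht, sub_self, mul_zero, mul_zero]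

/-- kernel: the same for the backward difference quotient ∂^{ξ*}_μ. [cite: Balaban1983Higgs3, (3.37)–(3.38) p.444] -/
theorem tsum_pdiffAdjZ_translate_eq_zero (ξ c : ℝ) (μ : Fin d) (F : ZSite d → ℝ) (hF : Summable F) (y' : ZSite d) :
    ∑' y : ZSite d, ξ ^ d * pdiffAdjZ c μ F (y - y') = 0 := by
  rw [← Equiv.tsum_eq (Equiv.addRight y') _]
  simp only [Equiv.coe_addRight, add_sub_cancel_right, pdiffAdjZ]
  have hs : Summable fun u : ZSite d => F (u - unitVec μ) :=
    (Equiv.subRight (unitVec μ)).summable_iff.mpr hF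
  have ht : ∑' u : ZSite d, F (u - unitVec μ) = ∑' u : ZSite d, F u :=
    Equiv.tsum_eq (Equiv.subRight (unitVec μ)) F
  rw [tsum_mul_left, tsum_mul_left, hs.tsum_sub hF, ht, sub_self, mul_zero, mul_zero]

/-- kernel: "a derivative of a constant" literally — the translated lattice sum y′ ↦ Σ_y ξ^d F(y − y′) is the constant
Σ_u ξ^d F(u), so its difference quotient in y′ vanishes (no summability needed for this form: `tsum` of a translate).
[cite: Balaban1983Higgs3, (3.37)–(3.38) p.444] -/
theorem pdiffZ_tsum_translate_eq_zero (ξ c : ℝ) (μ : Fin d) (F : ZSite d → ℝ) (y' : ZSite d) :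
    pdiffZ c μ (fun z : ZSite d => ∑' y : ZSite d, ξ ^ d * F (y - z)) y' = 0 := by
  have hconst : ∀ z : ZSite d, ∑' y : ZSite d, ξ ^ d * F (y - z) = ∑' u : ZSite d, ξ ^ d * F u := by
    intro z
    rw [← Equiv.tsum_eq (Equiv.addRight z) _]
    simp only [Equiv.coe_addRight, add_sub_cancel_right]
  simp only [pdiffZ, hconst, sub_self, mul_zero]

end TranslationInvariance

end

end Literature.MathematicalPhysics.QuantumFieldTheory.Balaban1983to89.B3Sect3TriangleGraphs
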